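import Mathlib

/-!
# Universal anchor lemma, part (b): the Hodge-type vectors `τ(a)` on `ℤ/(2g+2)` (solo-blind s62)

Combinatorial core of the UNIVERSAL ANCHOR LEMMA of the solo-blind notes (`paper/weil-det.md` §9, claim
C617; machine-checked there for all even `N ≤ 400`, here for every `g`).  Setting: `N = 2g+2`,
`J_N = Jac(y² = z^N − 1)`; the group `μ_N` acts on `H¹(J_N)` through the characters
`a ∈ ℤ/N ∖ {0, N/2}`, each once, and `H^{1,0}` corresponds to the open half-circle
`H = {1, …, g} ⊂ ℤ/N` (the `Finset` `H g`).  For a unit `u` (a Galois conjugation) the `u`-entry of the type vector of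
the character `a` is `τ(a)_u = [u·a ∈ H] ∈ {0,1}` (`tau`).  Part (b) of the lemma — the reason every
monomial of the σ′-Weil class at the `D_N`-symmetric anchor is a product of divisor classes — is:
* `mem_H_half_sub` : `N/2 − x ∈ H ↔ x ∈ H` (all `x`);
* `mem_H_neg`      : `−x ∈ H ↔ x ∉ H` for `x ∉ {0, N/2}`;
* `mem_H_add_half` : `x + N/2 ∈ H ↔ x ∉ H` for `x ∉ {0, N/2}`;
* `isUnit_mul_half`: units are odd, so `u·(N/2) = N/2`;
hence for every unit `u` and every character `a ∉ {0, N/2}`: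
`τ(−a)_u = τ(a + N/2)_u = 1 − τ(a)_u` (`tau_neg`, `tau_add_half`) and `τ(N/2 − a)_u = τ(a)_u`
(`tau_half_sub`): the pairs `{a, −a}` (polarisation type) and `{a, a + N/2}` (isogeny type) are BALANCED,
and `a ↦ N/2 − a` (the partner under `σ′`) preserves the type.  Pure `ZMod` arithmetic; bearing on the
summit statement: none directly (by-product certificate).
-/

namespace Summit.KontsevichZagierPeriods.KontsevichZagierPeriods.Theorems
namespace SoloBlind
namespace AnchorTypes

/-- `2g+2 ≠ 0`. -/
instance neZero_two_mul_add_two (g : ℕ) : NeZero (2 * g + 2) := ⟨by omega⟩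

variable (g : ℕ)

/-- The open half-circle `H = {1, …, g} ⊂ ℤ/(2g+2)` (the `H^{1,0}`-characters of `y² = z^{2g+2} − 1`). -/
def H : Finset (ZMod (2 * g + 2)) := Finset.univ.filter (fun x => 1 ≤ x.val ∧ x.val ≤ g)

/-- Membership in `H`: `1 ≤ val x ≤ g`. -/
theorem mem_H {x : ZMod (2 * g + 2)} : x ∈ H g ↔ 1 ≤ x.val ∧ x.val ≤ g := by simp [H]

/-- `N/2 = g + 1 ∈ ℤ/(2g+2)`. -/
def half : ZMod (2 * g + 2) := ((g + 1 : ℕ) : ZMod (2 * g + 2))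

/-- `val(N/2) = g + 1`. -/
theorem half_val : (half g).val = g + 1 := by
  unfold half
  rw [ZMod.val_natCast]
  exact Nat.mod_eq_of_lt (by omega)

/-- `N/2 ≠ 0`. -/
theorem half_ne_zero : half g ≠ 0 := by
  intro h
  have := congrArg ZMod.val h
  rw [half_val, ZMod.val_zero] at this
  omega

/-- `N/2 + N/2 = 0`. -/
theorem half_add_half : half g + half g = 0 := by
  unfold half
  rw [← Nat.cast_add, show g + 1 + (g + 1) = 2 * g + 2 by ring, ZMod.natCast_self]

/-- `0 ∉ H`. -/
theorem zero_not_mem_H : (0 : ZMod (2 * g + 2)) ∉ H g := by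
  rw [mem_H, ZMod.val_zero]; omega

/-- `N/2 ∉ H`. -/
theorem half_not_mem_H : half g ∉ H g := by
  rw [mem_H, half_val]; omega

section values
variable (x : ZMod (2 * g + 2))

/-- `A mod M` for `A < 2M`. -/
private theorem mod_of_lt_two_mul {A M : ℕ} (hA : A < 2 * M) :
    A % M = if A < M then A else A - M := by
  split_ifs with h
  · exact Nat.mod_eq_of_lt h
  · rw [Nat.mod_eq_sub_mod (by omega)]
    exact Nat.mod_eq_of_lt (by omega)

/-- `val(−x) = N − val x` for `x ≠ 0`. -/
theorem neg_val_of_ne_zero (hx : x ≠ 0) : (-x).val = 2 * g + 2 - x.val := by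
  rw [ZMod.neg_val, if_neg hx]

/-- `val(x + N/2)`. -/
theorem add_half_val :
    (x + half g).val = if x.val ≤ g then x.val + (g + 1) else x.val - (g + 1) := by
  have hx := ZMod.val_lt x
  rw [ZMod.val_add, half_val, mod_of_lt_two_mul (by omega)]
  split_ifs <;> omega

/-- `val(N/2 − x)`. -/
theorem half_sub_val :
    (half g - x).val = if x.val ≤ g + 1 then g + 1 - x.val else 3 * g + 3 - x.val := by
  have hx := ZMod.val_lt x
  rw [sub_eq_add_neg, ZMod.val_add, half_val]
  by_cases h0 : x = 0
  · subst h0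
    rw [neg_zero, ZMod.val_zero, add_zero, Nat.mod_eq_of_lt (by omega)]
    simp
  · rw [neg_val_of_ne_zero g x h0, mod_of_lt_two_mul (by omega)]
    have : 1 ≤ x.val := Nat.one_le_iff_ne_zero.mpr (fun h => h0 ((ZMod.val_eq_zero x).mp h))
    split_ifs <;> omega

end values

section partB
variable (x : ZMod (2 * g + 2))

/-- (b3) `N/2 − x ∈ H ↔ x ∈ H` — the map `a ↦ N/2 − a` preserves the half-circle. -/
theorem mem_H_half_sub : half g - x ∈ H g ↔ x ∈ H g := by
  have hx := ZMod.val_lt x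
  rw [mem_H, mem_H, half_sub_val]
  split_ifs <;> omega

/-- (b1) `−x ∈ H ↔ x ∉ H` for `x ∉ {0, N/2}`. -/
theorem mem_H_neg (h0 : x ≠ 0) (hh : x ≠ half g) : -x ∈ H g ↔ x ∉ H g := by
  have hx := ZMod.val_lt x
  have h1 : 1 ≤ x.val := Nat.one_le_iff_ne_zero.mpr (fun h => h0 ((ZMod.val_eq_zero x).mp h))
  have h2 : x.val ≠ g + 1 := by
    intro h
    apply hh
    apply ZMod.val_injective
    rw [h, half_val]
  rw [mem_H, mem_H, neg_val_of_ne_zero g x h0]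
  omega

/-- (b2) `x + N/2 ∈ H ↔ x ∉ H` for `x ∉ {0, N/2}`. -/
theorem mem_H_add_half (h0 : x ≠ 0) (hh : x ≠ half g) : x + half g ∈ H g ↔ x ∉ H g := by
  have hx := ZMod.val_lt x
  have h1 : 1 ≤ x.val := Nat.one_le_iff_ne_zero.mpr (fun h => h0 ((ZMod.val_eq_zero x).mp h))
  have h2 : x.val ≠ g + 1 := by
    intro h
    apply hh
    apply ZMod.val_injective
    rw [h, half_val]
  rw [mem_H, mem_H, add_half_val]
  split_ifs <;> omega

end partB

section units
variable {g}

/-- Units of `ℤ/(2g+2)` have odd representatives. -/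
theorem val_odd_of_isUnit {u : ZMod (2 * g + 2)} (hu : IsUnit u) : u.val % 2 = 1 := by
  obtain ⟨w, rfl⟩ := hu
  have hc := ZMod.val_coe_unit_coprime w
  by_contra hne
  have h2 : 2 ∣ (w : ZMod (2 * g + 2)).val := Nat.dvd_of_mod_eq_zero (by omega)
  have h2N : 2 ∣ 2 * g + 2 := ⟨g + 1, by ring⟩
  have h := Nat.dvd_gcd h2 h2N
  rw [Nat.Coprime.gcd_eq_one hc] at h
  exact absurd (Nat.le_of_dvd one_pos h) (by norm_num)

/-- `u · (N/2) = N/2` for every unit `u` (units are odd). -/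
theorem isUnit_mul_half {u : ZMod (2 * g + 2)} (hu : IsUnit u) : u * half g = half g := by
  apply ZMod.val_injective
  rw [ZMod.val_mul, half_val]
  obtain ⟨k, hk⟩ : ∃ k, u.val = 2 * k + 1 := ⟨u.val / 2, by have := val_odd_of_isUnit hu; omega⟩
  rw [hk, show (2 * k + 1) * (g + 1) = (g + 1) + k * (2 * g + 2) by ring, Nat.add_mul_mod_self_right]
  exact Nat.mod_eq_of_lt (by omega)

/-- `u·a ≠ 0` for a unit `u` and `a ≠ 0`. -/
theorem isUnit_mul_ne_zero {u a : ZMod (2 * g + 2)} (hu : IsUnit u) (ha : a ≠ 0) : u * a ≠ 0 := by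
  intro h
  obtain ⟨w, rfl⟩ := hu
  apply ha
  have := congrArg (fun z => (↑w⁻¹ : ZMod (2 * g + 2)) * z) h
  simpa using this

/-- `u·a ≠ N/2` for a unit `u` and `a ≠ N/2`. -/
theorem isUnit_mul_ne_half {u a : ZMod (2 * g + 2)} (hu : IsUnit u) (ha : a ≠ half g) :
    u * a ≠ half g := by
  intro h
  obtain ⟨w, hw⟩ := hu
  apply ha
  have hinv : IsUnit ((↑w⁻¹ : ZMod (2 * g + 2))) := Units.isUnit _
  have := congrArg (fun z => (↑w⁻¹ : ZMod (2 * g + 2)) * z) h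
  beta_reduce at this
  rw [← hw, ← mul_assoc, Units.inv_mul, one_mul, isUnit_mul_half hinv] at this
  exact this

end units

section tau
variable {g}

/-- The type-vector entry `τ(a)_u = [u·a ∈ H] ∈ {0,1}`. -/
def tau (g : ℕ) (a u : ZMod (2 * g + 2)) : ℕ := if u * a ∈ H g then 1 else 0

/-- `τ(a)_u ∈ {0,1}`. -/
theorem tau_le_one (a u : ZMod (2 * g + 2)) : tau g a u ≤ 1 := by
  unfold tau; split_ifs <;> omega

/-- `τ(−a)_u = 1 − τ(a)_u`: the pair `{a, −a}` is balanced. -/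
theorem tau_neg {a u : ZMod (2 * g + 2)} (hu : IsUnit u) (h0 : a ≠ 0) (hh : a ≠ half g) :
    tau g (-a) u = 1 - tau g a u := by
  have key := mem_H_neg g (u * a) (isUnit_mul_ne_zero hu h0) (isUnit_mul_ne_half hu hh)
  unfold tau
  rw [mul_neg]
  by_cases hP : u * a ∈ H g <;> simp [hP, key]

/-- `τ(a + N/2)_u = 1 − τ(a)_u`: the pair `{a, a + N/2}` is balanced. -/
theorem tau_add_half {a u : ZMod (2 * g + 2)} (hu : IsUnit u) (h0 : a ≠ 0) (hh : a ≠ half g) :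
    tau g (a + half g) u = 1 - tau g a u := by
  have key := mem_H_add_half g (u * a) (isUnit_mul_ne_zero hu h0) (isUnit_mul_ne_half hu hh)
  unfold tau
  rw [mul_add, isUnit_mul_half hu]
  by_cases hP : u * a ∈ H g <;> simp [hP, key]

/-- `τ(N/2 − a)_u = τ(a)_u`: the `σ′`-partner has the same type. -/
theorem tau_half_sub {a u : ZMod (2 * g + 2)} (hu : IsUnit u) :
    tau g (half g - a) u = tau g a u := by
  have key := mem_H_half_sub g (u * a)
  unfold tau
  rw [mul_sub, isUnit_mul_half hu]
  by_cases hP : u * a ∈ H g <;> simp [hP, key]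

/-- Balance in the additive form used in §9: `τ(a)_u + τ(−a)_u = 1` and `τ(a)_u + τ(a+N/2)_u = 1`. -/
theorem tau_add_tau_neg {a u : ZMod (2 * g + 2)} (hu : IsUnit u) (h0 : a ≠ 0) (hh : a ≠ half g) :
    tau g a u + tau g (-a) u = 1 := by
  rw [tau_neg hu h0 hh]; have := tau_le_one a u; omega

/-- `τ(a)_u + τ(a + N/2)_u = 1`. -/
theorem tau_add_tau_add_half {a u : ZMod (2 * g + 2)} (hu : IsUnit u) (h0 : a ≠ 0)
    (hh : a ≠ half g) : tau g a u + tau g (a + half g) u = 1 := by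
  rw [tau_add_half hu h0 hh]; have := tau_le_one a u; omega

end tau

/-- Sanity instance `g = 3` (`N = 8`, the anchor of §4): `H = {1,2,3}`, `5 ∉ H`, `N/2 = 4`. -/
example : (3 : ZMod 8) ∈ H 3 ∧ (5 : ZMod 8) ∉ H 3 ∧ half 3 = 4 := by decide

end AnchorTypes
end SoloBlind
end Summit.KontsevichZagierPeriods.KontsevichZagierPeriods.Theorems
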